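import Summits.Ventures.PercRepro.ProfilePointedCircuitClassesStarStarE

/-!
# PercRepro — THE IN–OUT INEQUALITY AT `ρ = 7`, I: THE SPANNING `5`-SUBSETS OF A `7`-POINT SPANNING SET
(p5, gen 41; `proofs/P5-GM1.md` §61)

`M` has rank `4` and no loops, `B ⊆ E` is a spanning `7`-point set.  Its spanning `5`-subsets `σ₅(B)` and its
PARALLEL PAIRS `Y` with `B ∖ Y` spanning, `q(B)`, satisfy **`30 ≤ 3·σ₅(B) + 2·q(B)`**
(`thirty_le_three_mul_card_add_two_mul_card`): if `B` has no three pairwise parallel points, a basis `B₀ ⊆ B`, an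
independent pair `Y` of the remaining three points and `S := B ∖ Y` give `σ₅(B) ≥ 1 + 3 + 3 + 3 = 10` by the
labels of part I–III (no point of `Y` is parallel to a parallel pair of `S`); if `B` has a parallel class of exactly
three points `p, p', p''`, `S := B ∖ {p', p''}` gives `σ₅(B) ≥ 1 + 3 + 3 + 2 = 9` (the two labels `{p, f}` of the pair
`{p', p''}` from the three labels of `p'`) and the three pairs of the class are parallel pairs with spanning
complement, `q ≥ 3`; if `B` has four pairwise parallel points `P`, the six `5`-sets `(B ∖ P) ∪ Y`, `Y ∈ C(P, 2)`,
span and `q ≥ 6`.  (`§59 ADDENDUM 3 (2)`: the deficient `7`-sets are the types I–III; here without the catalogue.)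
-/

open scoped Matroid

namespace PercRepro.Cogirth

open Finset ThmH Skew Shadow Profile

variable {α : Type} [DecidableEq α] {M : Matroid α} [M.Finite]

section SevenA

/-- The label count at `#Y = 2`: `1 + a(y) + a(y') + g(Y) ≤ σ₅(S ∪ Y)`. -/
theorem one_add_sum_add_le_card_spanning_five_of_card_two {S Y : Finset α} (hS5 : S.card = 5)
    (hSsp : rk M S = 4) (hSY : Disjoint S Y) (hY2 : Y.card = 2) :
    1 + (∑ y ∈ Y, (S.filter (fun s => rk M (insert y (S.erase s)) = 4)).card) +
      ((S.powersetCard 2).filter (fun A => rk M ((S \ A) ∪ Y) = 4)).card ≤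
      (((S ∪ Y).powersetCard 5).filter (fun X => rk M X = 4)).card := by
  have h := sum_card_filter_le_card_spanning_five (M := M) hS5 hSY
  rw [sum_range_four_eq hSsp] at h
  have e2 : Y.powersetCard 2 = {Y} := by
    ext Z
    rw [mem_powersetCard, mem_singleton]
    constructor
    · rintro ⟨hZY, hZ2⟩
      exact eq_of_subset_of_card_le hZY (by omega)
    · rintro rfl
      exact ⟨Subset.refl _, hY2⟩
  rw [e2, sum_singleton] at h
  omega

/-- **A point not parallel to any parallel pair of `S` has three labels**: by (P), or by the parallel-pair lemma
of part III. -/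
theorem three_le_card_filter_of_not_parallel (hR : rk M (gr M) = 4) (hll : ∀ x ∈ gr M, rk M {x} = 1)
    {S : Finset α} (hS : S ⊆ gr M) (hS5 : S.card = 5) (hSsp : rk M S = 4) {y : α} (hy : y ∈ gr M) (hyS : y ∉ S)
    (hnp : ∀ t ∈ S, ∀ t' ∈ S, t ≠ t' → rk M {t, t'} ≤ 1 → ¬ rk M {t, y} ≤ 1) :
    3 ≤ (S.filter (fun s => rk M (insert y (S.erase s)) = 4)).card := by
  rcases three_le_card_filter_or_exists_parallel_pair hR hS hS5 hSsp hy hyS with h | ⟨t, ht, t', ht', htt', hpar⟩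
  · exact h
  · exact three_le_card_filter_of_parallel_pair_of_not hR hll hS hS5 hSsp ht ht' htt' hpar hy
      (hnp t ht t' ht' htt' hpar)

/-- Three points with a common parallel partner are pairwise parallel: `ρ{t, t'} ≤ 1`, `ρ{t, y} ≤ 1` ⟹
`ρ{t, t', y} ≤ 1`. -/
theorem rk_triple_le_one_of_parallel (hll : ∀ x ∈ gr M, rk M {x} = 1) {t t' y : α} (ht : t ∈ gr M)
    (h1 : rk M {t, t'} ≤ 1) (h2 : rk M {t, y} ≤ 1) : rk M {t, t', y} ≤ 1 := by
  have h := rk_union_add_rk_inter_le (M := M) {t, t'} {t, y}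
  have hu : ({t, t'} : Finset α) ∪ {t, y} = {t, t', y} := by
    ext x
    simp only [mem_union, mem_insert, mem_singleton]
    tauto
  have hi : ({t} : Finset α) ⊆ ({t, t'} : Finset α) ∩ {t, y} := by
    intro x hx
    rw [mem_singleton] at hx
    subst hx
    exact mem_inter.2 ⟨mem_insert_self _ _, mem_insert_self _ _⟩
  have h3 := rk_mono' (M := M) hi
  rw [hll t ht] at h3
  rw [hu] at h
  omega

/-- **Case 1: no three pairwise parallel points — `σ₅(B) ≥ 10`.** -/
theorem ten_le_card_spanning_five_of_no_triple (hR : rk M (gr M) = 4) (hll : ∀ x ∈ gr M, rk M {x} = 1)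
    {B : Finset α} (hB : B ⊆ gr M) (hB7 : B.card = 7) (hBsp : rk M B = 4)
    (hno : ∀ Z ∈ B.powersetCard 3, ¬ rk M Z ≤ 1) :
    10 ≤ ((B.powersetCard 5).filter (fun X => rk M X = 4)).card := by
  -- a basis `B₀ ⊆ B`
  obtain ⟨B₀, -, hB₀B, hB₀c, hB₀r⟩ := exists_indep_between hB (empty_subset B)
    (by have h := rk_le_card (M := M) ∅; rw [card_empty] at h ⊢; omega) (by rw [hBsp, hR])
  rw [hR] at hB₀c
  have hF3 : (B \ B₀).card = 3 := by rw [card_sdiff_of_subset hB₀B, hB7, hB₀c]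
  obtain ⟨f₁, f₂, f₃, h12, h13, h23, hFeq⟩ := card_eq_three.1 hF3
  have hf : ∀ f ∈ ({f₁, f₂, f₃} : Finset α), f ∈ B ∧ f ∉ B₀ := by
    intro f hf
    rw [← hFeq] at hf
    exact mem_sdiff.1 hf
  -- two of the three are independent
  obtain ⟨y, y', f'', hyy', hsub, hyB, hy'B, hf''B, hyB₀, hy'B₀, hf''B₀, hyf'', hy'f'', hind⟩ :
      ∃ y y' f'' : α, y ≠ y' ∧ ({y, y', f''} : Finset α) = {f₁, f₂, f₃} ∧ y ∈ B ∧ y' ∈ B ∧ f'' ∈ B ∧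
        y ∉ B₀ ∧ y' ∉ B₀ ∧ f'' ∉ B₀ ∧ y ≠ f'' ∧ y' ≠ f'' ∧ ¬ rk M {y, y'} ≤ 1 := by
    have hF := hno {f₁, f₂, f₃} (by
      rw [mem_powersetCard]
      refine ⟨fun f hf' => (hf f hf').1, ?_⟩
      rw [card_insert_of_notMem, card_pair h23]
      rw [mem_insert, mem_singleton, not_or]
      exact ⟨h12, h13⟩)
    by_cases h12' : rk M {f₁, f₂} ≤ 1
    · by_cases h13' : rk M {f₁, f₃} ≤ 1
      · exact absurd (rk_triple_le_one_of_parallel hll (hB (hf f₁ (mem_insert_self _ _)).1) h12' h13') hF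
      · refine ⟨f₁, f₃, f₂, h13, ?_, (hf f₁ (mem_insert_self _ _)).1,
          (hf f₃ (mem_insert_of_mem (mem_insert_of_mem (mem_singleton_self _)))).1,
          (hf f₂ (mem_insert_of_mem (mem_insert_self _ _))).1, (hf f₁ (mem_insert_self _ _)).2,
          (hf f₃ (mem_insert_of_mem (mem_insert_of_mem (mem_singleton_self _)))).2,
          (hf f₂ (mem_insert_of_mem (mem_insert_self _ _))).2, h12, h23.symm, h13'⟩
        ext x
        simp only [mem_insert, mem_singleton]
        tauto
    · exact ⟨f₁, f₂, f₃, h12, rfl, (hf f₁ (mem_insert_self _ _)).1,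
        (hf f₂ (mem_insert_of_mem (mem_insert_self _ _))).1,
        (hf f₃ (mem_insert_of_mem (mem_insert_of_mem (mem_singleton_self _)))).1,
        (hf f₁ (mem_insert_self _ _)).2, (hf f₂ (mem_insert_of_mem (mem_insert_self _ _))).2,
        (hf f₃ (mem_insert_of_mem (mem_insert_of_mem (mem_singleton_self _)))).2, h13, h23, h12'⟩
  -- `S := B₀ + f''`, `Y := {y, y'}`, `S ∪ Y = B`
  have hSdef : B = insert f'' B₀ ∪ {y, y'} := by
    have hBeq : B = B₀ ∪ (B \ B₀) := (union_sdiff_of_subset hB₀B).symm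
    rw [hBeq, hFeq, ← hsub]
    ext x
    simp only [mem_union, mem_insert, mem_singleton]
    tauto
  have hSg : insert f'' B₀ ⊆ gr M := insert_subset (hB hf''B) (hB₀B.trans hB)
  have hS5 : (insert f'' B₀).card = 5 := by rw [card_insert_of_notMem hf''B₀, hB₀c]
  have hSsp : rk M (insert f'' B₀) = 4 := by
    have h1 := rk_mono' (M := M) (subset_insert f'' B₀)
    have h2 := rk_le_rk_gr (M := M) hSg
    omega
  have hSY : Disjoint (insert f'' B₀) {y, y'} := by
    rw [disjoint_left]
    intro x hx hxY
    rw [mem_insert] at hx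
    rw [mem_insert, mem_singleton] at hxY
    rcases hxY with h | h <;> rw [h] at hx <;> rcases hx with h' | h'
    · exact hyf'' h'
    · exact hyB₀ h'
    · exact hy'f'' h'
    · exact hy'B₀ h'
  have hY : ({y, y'} : Finset α) ⊆ gr M \ insert f'' B₀ := by
    intro x hx
    rw [mem_sdiff]
    refine ⟨?_, fun h => disjoint_left.1 hSY h hx⟩
    rw [mem_insert, mem_singleton] at hx
    rcases hx with h | h <;> rw [h]
    · exact hB hyB
    · exact hB hy'B
  have hmain := one_add_sum_add_le_card_spanning_five_of_card_two (M := M) hS5 hSsp hSY (card_pair hyy')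
  rw [← hSdef] at hmain
  -- no point of `Y` is parallel to a parallel pair of `S`
  have hnp : ∀ w ∈ ({y, y'} : Finset α), ∀ t ∈ insert f'' B₀, ∀ t' ∈ insert f'' B₀, t ≠ t' →
      rk M {t, t'} ≤ 1 → ¬ rk M {t, w} ≤ 1 := by
    intro w hw t ht t' ht' htt' hpar hpw
    have htB : t ∈ B := by rw [hSdef]; exact mem_union_left _ ht
    have ht'B : t' ∈ B := by rw [hSdef]; exact mem_union_left _ ht'
    have hwB : w ∈ B := by rw [hSdef]; exact mem_union_right _ hw
    have hwt : w ≠ t := fun h => disjoint_left.1 hSY ht (h ▸ hw)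
    have hwt' : w ≠ t' := fun h => disjoint_left.1 hSY ht' (h ▸ hw)
    apply hno {t, t', w}
    · rw [mem_powersetCard]
      refine ⟨?_, ?_⟩
      · intro x hx
        rw [mem_insert, mem_insert, mem_singleton] at hx
        rcases hx with h | h | h <;> rw [h] <;> assumption
      · rw [card_insert_of_notMem, card_pair hwt'.symm]
        rw [mem_insert, mem_singleton, not_or]
        exact ⟨htt', hwt.symm⟩
    · exact rk_triple_le_one_of_parallel hll (hB htB) hpar hpw
  have hay : 3 ≤ ((insert f'' B₀).filter (fun s => rk M (insert y ((insert f'' B₀).erase s)) = 4)).card :=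
    three_le_card_filter_of_not_parallel hR hll hSg hS5 hSsp (hB hyB) (fun h => disjoint_left.1 hSY h
      (mem_insert_self _ _)) (hnp y (mem_insert_self _ _))
  have hay' : 3 ≤ ((insert f'' B₀).filter (fun s => rk M (insert y' ((insert f'' B₀).erase s)) = 4)).card :=
    three_le_card_filter_of_not_parallel hR hll hSg hS5 hSsp (hB hy'B) (fun h => disjoint_left.1 hSY h
      (mem_insert_of_mem (mem_singleton_self _))) (hnp y' (mem_insert_of_mem (mem_singleton_self _)))
  have hsum : 6 ≤ ∑ w ∈ ({y, y'} : Finset α),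
      ((insert f'' B₀).filter (fun s => rk M (insert w ((insert f'' B₀).erase s)) = 4)).card := by
    rw [sum_pair hyy']
    omega
  have hg : 3 ≤ (((insert f'' B₀).powersetCard 2).filter
      (fun A => rk M ((insert f'' B₀ \ A) ∪ {y, y'}) = 4)).card := by
    have hrk : rk M {y, y'} = 2 := by
      have := (rk_le_card (M := M) {y, y'}).trans card_le_two
      omega
    have := succ_card_le_card_filter_of_indep hR hSg hS5 hSsp hY (Subset.refl _) (by rw [card_pair hyy']; omega)
      (by rw [hrk, card_pair hyy'])
    rw [card_pair hyy'] at this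
    exact this
  omega

end SevenA

end PercRepro.Cogirth
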